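import Mathlib
import HarnessLib
import Summits.Ventures.LatticeQCDFlow.Scoring.RegenerativeStrongLaw
import Summits.Ventures.LatticeQCDFlow.Scoring.RegenerativeEstimatorSharp
import Summits.Ventures.LatticeQCDFlow.Scoring.RegenerativeTourCovarianceSq
import Summits.Ventures.LatticeQCDFlow.Scoring.TourVarianceGeneral

/-!
# The plug-in tour variance is STRONGLY consistent: `V̂_R → σ²_f / e` and `V̂_R / N̄_R → σ²_f`
# almost surely, from any start — a one-run estimator of the Green–Kubo variance

HONEST FRAMING: exact (Metropolis-corrected) sampling algorithms for lattice gauge theory;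
figures of merit are autocorrelation/cost numbers at stated couplings and volumes; no
continuum-physics claim.

Venture `LatticeQCDFlow` (cell pub-lqcd), topic `Scoring`; FANOUT row 8 (`s0-cpn-nemc`, GEN-18).
NEW WORK of the cell, not a published result; no definition is introduced.  Notation of
`Scoring/RegenerativeCLTStudentized.lean`: tours `1, …, R` of the split chain from ANY initial law,
`Y_i, N_i` tour sums and lengths, `Â_R = Σ Y_i/Σ N_i`, `N̄_R = Σ N_i/R`,
`V̂_R = (1/R) Σ (Y_i − Â_R N_i)²`, `v = E_ν̂[Z_0²] = σ²_f/e`.  Since the tour pairs are i.i.d.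
(`Scoring/SplitChainTourIID.lean`) with `E[Y_1²], E[N_1²] < ∞`, Mathlib's strong law gives the almost
sure limits of `(1/R)ΣY_i²`, `(1/R)ΣY_iN_i`, `(1/R)ΣN_i²`; expanding the square,
`V̂_R = avg(Y²) − 2Â_R avg(YN) + Â_R² avg(N²) → E_ν̂[(Y_0 − c N_0)²] = v` almost surely (with
`Â_R → c` a.s., `Scoring/RegenerativeStrongLaw.lean`), and `V̂_R / N̄_R → v e = σ²_f`: THE GREEN–KUBO
(τ_int) VARIANCE IS ESTIMATED STRONGLY CONSISTENTLY FROM ONE RUN by the regenerative statistic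
`σ̂²_R = V̂_R / N̄_R` — the input for studentised confidence intervals of plain time averages
(`Scoring/MarkovChainCLTStudentized.lean`).  Printed counterpart NAMED ONLY: Mykland–Tierney–Yu 1995
§3; Hobert–Jones–Presnell–Rosenthal 2002 Thm 2 (strong consistency of the regenerative variance
estimator) — nothing is cited as a fact.

## Content (`π` invariant, `0 < ε < 1`, `|f| ≤ C` measurable, any initial law)

* `splitChain_tourPairProducts_strongLaw` — a.s. limits of `(1/R)ΣY²`, `(1/R)ΣYN`, `(1/R)ΣN²`;
* **`regenerative_variance_strongLaw`** — `V̂_R → σ²_f / e` almost surely;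
* **`regenerative_sigma_strongLaw`** — `V̂_R / N̄_R → σ²_f` almost surely.

NOT CLAIMED: rates; unbounded `f`; any `ε` of a concrete sampler.
-/

noncomputable section

namespace Summit.Ventures.LatticeQCDFlow.Scoring

open MeasureTheory ProbabilityTheory Filter Finset Preorder Literature.Probability.MarkovChains
open scoped ENNReal Topology

section VarianceSLLN

variable {Ω : Type*} [MeasurableSpace Ω]
  {κ : Kernel Ω Ω} [IsMarkovKernel κ] {ν : Measure Ω} [IsProbabilityMeasure ν] {ε : ℝ≥0∞}
  {hmin : ∀ x {B : Set Ω}, MeasurableSet B → ε * ν B ≤ κ x B}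
  (κs : Kernel (Ω × Bool) (Ω × Bool)) [IsMarkovKernel κs]
  (μs : Measure (Ω × Bool)) [IsProbabilityMeasure μs]

/-- **Strong laws for the second-moment averages of the tour pairs**: almost surely
`(1/R)Σ_{i<R} Y_{i+1}² → E_ν̂[Y_0²]`, `(1/R)Σ Y_{i+1}N_{i+1} → E_ν̂[Y_0 N_0]`, `(1/R)Σ N_{i+1}² → E_ν̂[N_0²]`. -/
theorem splitChain_tourPairProducts_strongLaw (hε0 : 0 < ε) (hε : ε < 1)
    (hκs : ∀ p, κs p = (ε • ν).map (fun y : Ω => (y, true))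
      + ((1 - ε) • Doeblin.residualKernel κ ν ε hmin p.1).map (fun y : Ω => (y, false)))
    {f : Ω → ℝ} (hf : Measurable f) {C : ℝ} (hC : ∀ x, |f x| ≤ C) :
    ∀ᵐ x ∂(Kernel.trajMeasure (X := fun _ : ℕ => Ω × Bool) μs
        (fun m : ℕ => κs.comap (fun h : (i : ↥(Finset.Iic m)) → Ω × Bool =>
          h ⟨m, Finset.mem_Iic.2 le_rfl⟩) (measurable_pi_apply _))),
      Tendsto (fun R : ℕ => (∑ i ∈ Finset.range R, (∑' u, (if (∑ s ∈ Finset.range u, (if (x (s + 1)).2 then (1 : ℕ) else 0)) = i + 1 then (1 : ℝ) else 0) * f (x u).1) ^ 2) / R) atTop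
          (𝓝 (∫ y, (∑' u, (if (∑ s ∈ Finset.range u, (if (y (s + 1)).2 then (1 : ℕ) else 0)) = 0 then (1 : ℝ) else 0) * f (y u).1) ^ 2 ∂(Kernel.trajMeasure (X := fun _ : ℕ => Ω × Bool) (ν.map (fun y : Ω => (y, true)))
        (fun m : ℕ => κs.comap (fun h : (i : ↥(Finset.Iic m)) → Ω × Bool =>
          h ⟨m, Finset.mem_Iic.2 le_rfl⟩) (measurable_pi_apply _)))))
      ∧ Tendsto (fun R : ℕ => (∑ i ∈ Finset.range R, (∑' u, (if (∑ s ∈ Finset.range u, (if (x (s + 1)).2 then (1 : ℕ) else 0)) = i + 1 then (1 : ℝ) else 0) * f (x u).1) * (∑' u, (if (∑ s ∈ Finset.range u, (if (x (s + 1)).2 then (1 : ℕ) else 0)) = i + 1 then (1 : ℝ) else 0))) / R) atTop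
          (𝓝 (∫ y, (∑' u, (if (∑ s ∈ Finset.range u, (if (y (s + 1)).2 then (1 : ℕ) else 0)) = 0 then (1 : ℝ) else 0) * f (y u).1) * (∑' u, (if (∑ s ∈ Finset.range u, (if (y (s + 1)).2 then (1 : ℕ) else 0)) = 0 then (1 : ℝ) else 0)) ∂(Kernel.trajMeasure (X := fun _ : ℕ => Ω × Bool) (ν.map (fun y : Ω => (y, true)))
        (fun m : ℕ => κs.comap (fun h : (i : ↥(Finset.Iic m)) → Ω × Bool =>
          h ⟨m, Finset.mem_Iic.2 le_rfl⟩) (measurable_pi_apply _)))))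
      ∧ Tendsto (fun R : ℕ => (∑ i ∈ Finset.range R, (∑' u, (if (∑ s ∈ Finset.range u, (if (x (s + 1)).2 then (1 : ℕ) else 0)) = i + 1 then (1 : ℝ) else 0)) ^ 2) / R) atTop
          (𝓝 (∫ y, (∑' u, (if (∑ s ∈ Finset.range u, (if (y (s + 1)).2 then (1 : ℕ) else 0)) = 0 then (1 : ℝ) else 0)) ^ 2 ∂(Kernel.trajMeasure (X := fun _ : ℕ => Ω × Bool) (ν.map (fun y : Ω => (y, true)))
        (fun m : ℕ => κs.comap (fun h : (i : ↥(Finset.Iic m)) → Ω × Bool =>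
          h ⟨m, Finset.mem_Iic.2 le_rfl⟩) (measurable_pi_apply _))))) := by
  haveI hνt : IsProbabilityMeasure (ν.map (fun y : Ω => (y, true))) :=
    Measure.isProbabilityMeasure_map (measurable_tagCoin true).aemeasurable
  set P := (Kernel.trajMeasure (X := fun _ : ℕ => Ω × Bool) μs
        (fun m : ℕ => κs.comap (fun h : (i : ↥(Finset.Iic m)) → Ω × Bool =>
          h ⟨m, Finset.mem_Iic.2 le_rfl⟩) (measurable_pi_apply _))) with hP
  set Pν := (Kernel.trajMeasure (X := fun _ : ℕ => Ω × Bool) (ν.map (fun y : Ω => (y, true)))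
        (fun m : ℕ => κs.comap (fun h : (i : ↥(Finset.Iic m)) → Ω × Bool =>
          h ⟨m, Finset.mem_Iic.2 le_rfl⟩) (measurable_pi_apply _))) with hPν
  -- the i.i.d. tour pairs `(Y_{i+1}, N_{i+1})`
  have hT := splitChain_tourPairs_iIndepFun κs μs (κ := κ) (ν := ν) (hmin := hmin) hε0 hε hκs
    (g₁ := f) (g₂ := fun _ => (1 : ℝ)) hf measurable_const
  have hTid := fun i => splitChain_tourPair_identDistrib κs μs (κ := κ) (ν := ν) (hmin := hmin) hε0
    hε hκs (g₁ := f) (g₂ := fun _ => (1 : ℝ)) hf measurable_const i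
  have hT0 := splitChain_tourPair_identDistrib_fresh κs μs (κ := κ) (ν := ν) (hmin := hmin) hε0 hε
    hκs (g₁ := f) (g₂ := fun _ => (1 : ℝ)) hf measurable_const 0
  rw [← hP] at hT hTid
  rw [← hP, ← hPν] at hT0
  have hbr : ∀ (y : ℕ → Ω × Bool) (a : ℕ), (∑' u, (if (∑ s ∈ Finset.range u,
      (if (y (s + 1)).2 then (1 : ℕ) else 0)) = a then (1 : ℝ) else 0) * (1 : ℝ))
      = ∑' u, (if (∑ s ∈ Finset.range u, (if (y (s + 1)).2 then (1 : ℕ) else 0)) = a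
        then (1 : ℝ) else 0) := fun y a => tsum_congr fun u => mul_one _
  -- integrability of the three products under the fresh first tour
  have hY0sq : Integrable (fun y => (∑' u, (if (∑ s ∈ Finset.range u, (if (y (s + 1)).2 then (1 : ℕ) else 0)) = 0 then (1 : ℝ) else 0) * f (y u).1) ^ 2) Pν := by
    have h := (splitChain_fresh_sq_tourSum_le κs (ν.map (fun y : Ω => (y, true))) (κ := κ) (ν := ν)
      (hmin := hmin) hε0 hε hκs hf hC).1
    rw [← hPν] at h; exact h
  have hN0sq : Integrable (fun y => (∑' u, (if (∑ s ∈ Finset.range u, (if (y (s + 1)).2 then (1 : ℕ) else 0)) = 0 then (1 : ℝ) else 0)) ^ 2) Pν := by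
    have h := (splitChain_integral_sq_tourLength_zero κs (ν.map (fun y : Ω => (y, true))) (κ := κ)
      (ν := ν) (hmin := hmin) hε0 hε hκs).1
    rw [← hPν] at h; exact h
  have hYN0 : Integrable (fun y => (∑' u, (if (∑ s ∈ Finset.range u, (if (y (s + 1)).2 then (1 : ℕ) else 0)) = 0 then (1 : ℝ) else 0) * f (y u).1) * (∑' u, (if (∑ s ∈ Finset.range u, (if (y (s + 1)).2 then (1 : ℕ) else 0)) = 0 then (1 : ℝ) else 0))) Pν := by
    refine Integrable.mono' ((hY0sq.add hN0sq).div_const 2) ?_ (ae_of_all _ fun y => ?_)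
    · exact ((measurable_tourSum (Ω := Ω) (ψ := fun p _ => f p.1)
        (hf.comp (measurable_fst.comp measurable_fst)) 0).mul
        (Measurable.tsum fun u => measurable_headCountIndicator u 0)).aestronglyMeasurable
    · simp only [Pi.add_apply]
      rw [Real.norm_eq_abs, abs_mul]
      nlinarith [sq_nonneg (|(∑' u, (if (∑ s ∈ Finset.range u, (if (y (s + 1)).2 then (1 : ℕ) else 0)) = 0 then (1 : ℝ) else 0) * f (y u).1)| - |(∑' u, (if (∑ s ∈ Finset.range u, (if (y (s + 1)).2 then (1 : ℕ) else 0)) = 0 then (1 : ℝ) else 0))|), sq_abs (∑' u, (if (∑ s ∈ Finset.range u, (if (y (s + 1)).2 then (1 : ℕ) else 0)) = 0 then (1 : ℝ) else 0) * f (y u).1), sq_abs (∑' u, (if (∑ s ∈ Finset.range u, (if (y (s + 1)).2 then (1 : ℕ) else 0)) = 0 then (1 : ℝ) else 0))]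
  -- the three i.i.d. scalar sequences and their strong laws
  have key : ∀ (φ : ℝ × ℝ → ℝ), Measurable φ →
      Integrable (fun y => φ ((∑' u, (if (∑ s ∈ Finset.range u, (if (y (s + 1)).2 then (1 : ℕ) else 0)) = 0 then (1 : ℝ) else 0) * f (y u).1), (∑' u, (if (∑ s ∈ Finset.range u, (if (y (s + 1)).2 then (1 : ℕ) else 0)) = 0 then (1 : ℝ) else 0)))) Pν →
      ∀ᵐ x ∂P, Tendsto (fun R : ℕ => (∑ i ∈ Finset.range R, φ ((∑' u, (if (∑ s ∈ Finset.range u, (if (x (s + 1)).2 then (1 : ℕ) else 0)) = i + 1 then (1 : ℝ) else 0) * f (x u).1), (∑' u, (if (∑ s ∈ Finset.range u, (if (x (s + 1)).2 then (1 : ℕ) else 0)) = i + 1 then (1 : ℝ) else 0)))) / R) atTop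
        (𝓝 (∫ y, φ ((∑' u, (if (∑ s ∈ Finset.range u, (if (y (s + 1)).2 then (1 : ℕ) else 0)) = 0 then (1 : ℝ) else 0) * f (y u).1), (∑' u, (if (∑ s ∈ Finset.range u, (if (y (s + 1)).2 then (1 : ℕ) else 0)) = 0 then (1 : ℝ) else 0))) ∂Pν)) := by
    intro φ hφ hI
    have hX := hT.comp (fun _ => φ) (fun _ => hφ)
    have hXid := fun i => (hTid i).comp hφ
    have hX0 := hT0.comp hφ
    simp only [Function.comp_def, hbr, Nat.zero_add] at hX hXid hX0
    have hI1 : Integrable (fun x : ℕ → Ω × Bool => φ ((∑' u, (if (∑ s ∈ Finset.range u, (if (x (s + 1)).2 then (1 : ℕ) else 0)) = 1 then (1 : ℝ) else 0) * f (x u).1), (∑' u, (if (∑ s ∈ Finset.range u, (if (x (s + 1)).2 then (1 : ℕ) else 0)) = 1 then (1 : ℝ) else 0)))) P := by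
      exact (hX0.integrable_iff).2 hI
    have hE1 : ∫ x, φ ((∑' u, (if (∑ s ∈ Finset.range u, (if (x (s + 1)).2 then (1 : ℕ) else 0)) = 1 then (1 : ℝ) else 0) * f (x u).1), (∑' u, (if (∑ s ∈ Finset.range u, (if (x (s + 1)).2 then (1 : ℕ) else 0)) = 1 then (1 : ℝ) else 0))) ∂P = ∫ y, φ ((∑' u, (if (∑ s ∈ Finset.range u, (if (y (s + 1)).2 then (1 : ℕ) else 0)) = 0 then (1 : ℝ) else 0) * f (y u).1), (∑' u, (if (∑ s ∈ Finset.range u, (if (y (s + 1)).2 then (1 : ℕ) else 0)) = 0 then (1 : ℝ) else 0))) ∂Pν :=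
      hX0.integral_eq
    have h := strong_law_ae_real (fun (i : ℕ) (x : ℕ → Ω × Bool) => φ ((∑' u, (if (∑ s ∈ Finset.range u, (if (x (s + 1)).2 then (1 : ℕ) else 0)) = i + 1 then (1 : ℝ) else 0) * f (x u).1), (∑' u, (if (∑ s ∈ Finset.range u, (if (x (s + 1)).2 then (1 : ℕ) else 0)) = i + 1 then (1 : ℝ) else 0))))
      hI1 (fun i j hij => hX.indepFun hij) hXid
    rw [hE1] at h
    exact h
  have h1 := key (fun p => p.1 ^ 2) (measurable_fst.pow_const 2) hY0sq
  have h2 := key (fun p => p.1 * p.2) (measurable_fst.mul measurable_snd) hYN0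
  have h3 := key (fun p => p.2 ^ 2) (measurable_snd.pow_const 2) hN0sq
  filter_upwards [h1, h2, h3] with x hx1 hx2 hx3
  exact ⟨hx1, hx2, hx3⟩

/-- **THE PLUG-IN TOUR VARIANCE IS STRONGLY CONSISTENT**: `π` invariant, `0 < ε < 1`, `|f| ≤ C`
measurable, any initial law: almost surely `V̂_R = (1/R) Σ_{i<R} (Y_{i+1} − Â_R N_{i+1})² → σ²_f / e`. -/
theorem regenerative_variance_strongLaw {π : Measure Ω} [IsProbabilityMeasure π]
    (hπ : Kernel.Invariant κ π) (hε0 : 0 < ε) (hε : ε < 1)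
    (hκs : ∀ p, κs p = (ε • ν).map (fun y : Ω => (y, true))
      + ((1 - ε) • Doeblin.residualKernel κ ν ε hmin p.1).map (fun y : Ω => (y, false)))
    {f : Ω → ℝ} (hf : Measurable f) {C : ℝ} (hC : ∀ x, |f x| ≤ C) :
    ∀ᵐ x ∂(Kernel.trajMeasure (X := fun _ : ℕ => Ω × Bool) μs
        (fun m : ℕ => κs.comap (fun h : (i : ↥(Finset.Iic m)) → Ω × Bool =>
          h ⟨m, Finset.mem_Iic.2 le_rfl⟩) (measurable_pi_apply _))),
      Tendsto (fun R : ℕ => ((∑ i ∈ Finset.range R, ((∑' u, (if (∑ s ∈ Finset.range u, (if (x (s + 1)).2 then (1 : ℕ) else 0)) = i + 1 then (1 : ℝ) else 0) * f (x u).1) - ((∑ i ∈ Finset.range R, (∑' u, (if (∑ s ∈ Finset.range u, (if (x (s + 1)).2 then (1 : ℕ) else 0)) = i + 1 then (1 : ℝ) else 0) * f (x u).1)) / (∑ i ∈ Finset.range R, (∑' u, (if (∑ s ∈ Finset.range u, (if (x (s + 1)).2 then (1 : ℕ) else 0)) = i + 1 then (1 : ℝ) else 0)))) * (∑' u, (if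 (∑ s ∈ Finset.range u, (if (x (s + 1)).2 then (1 : ℕ) else 0)) = i + 1 then (1 : ℝ) else 0))) ^ 2) / R)) atTop (𝓝 (((∫ y, (f y - ∫ z, f z ∂π) ^ 2 ∂π)
      + 2 * ∑' k, ∫ y, (f y - ∫ z, f z ∂π) * (kop κ)^[k + 1] (fun y => f y - ∫ z, f z ∂π) y ∂π) / ε.toReal)) := by
  haveI hνt : IsProbabilityMeasure (ν.map (fun y : Ω => (y, true))) :=
    Measure.isProbabilityMeasure_map (measurable_tagCoin true).aemeasurable
  set P := (Kernel.trajMeasure (X := fun _ : ℕ => Ω × Bool) μs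
        (fun m : ℕ => κs.comap (fun h : (i : ↥(Finset.Iic m)) → Ω × Bool =>
          h ⟨m, Finset.mem_Iic.2 le_rfl⟩) (measurable_pi_apply _))) with hP
  set Pν := (Kernel.trajMeasure (X := fun _ : ℕ => Ω × Bool) (ν.map (fun y : Ω => (y, true)))
        (fun m : ℕ => κs.comap (fun h : (i : ↥(Finset.Iic m)) → Ω × Bool =>
          h ⟨m, Finset.mem_Iic.2 le_rfl⟩) (measurable_pi_apply _))) with hPν
  set c := ∫ z, f z ∂π with hc
  set σ2 := ((∫ y, (f y - ∫ z, f z ∂π) ^ 2 ∂π)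
      + 2 * ∑' k, ∫ y, (f y - ∫ z, f z ∂π) * (kop κ)^[k + 1] (fun y => f y - ∫ z, f z ∂π) y ∂π) with hσ2
  have he0 : 0 < ε.toReal := ENNReal.toReal_pos hε0.ne' (ne_top_of_lt hε)
  obtain ⟨hg, hCg, -⟩ := centred_observable_bounds π hf hC
  -- the limit value: `E_ν̂[Y_0²] − 2c E_ν̂[Y_0N_0] + c² E_ν̂[N_0²] = E_ν̂[Z_0²] = σ²/e`
  have hY0sq : Integrable (fun y => (∑' u, (if (∑ s ∈ Finset.range u, (if (y (s + 1)).2 then (1 : ℕ) else 0)) = 0 then (1 : ℝ) else 0) * f (y u).1) ^ 2) Pν := by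
    have h := (splitChain_fresh_sq_tourSum_le κs (ν.map (fun y : Ω => (y, true))) (κ := κ) (ν := ν)
      (hmin := hmin) hε0 hε hκs hf hC).1
    rw [← hPν] at h; exact h
  have hN0sq : Integrable (fun y => (∑' u, (if (∑ s ∈ Finset.range u, (if (y (s + 1)).2 then (1 : ℕ) else 0)) = 0 then (1 : ℝ) else 0)) ^ 2) Pν := by
    have h := (splitChain_integral_sq_tourLength_zero κs (ν.map (fun y : Ω => (y, true))) (κ := κ)
      (ν := ν) (hmin := hmin) hε0 hε hκs).1
    rw [← hPν] at h; exact h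
  have hYm0 : Measurable fun y : ℕ → Ω × Bool => (∑' u, (if (∑ s ∈ Finset.range u, (if (y (s + 1)).2 then (1 : ℕ) else 0)) = 0 then (1 : ℝ) else 0) * f (y u).1) :=
    measurable_tourSum (Ω := Ω) (ψ := fun p _ => f p.1) (hf.comp (measurable_fst.comp measurable_fst)) 0
  have hNm0 : Measurable fun y : ℕ → Ω × Bool => (∑' u, (if (∑ s ∈ Finset.range u, (if (y (s + 1)).2 then (1 : ℕ) else 0)) = 0 then (1 : ℝ) else 0)) :=
    Measurable.tsum fun u => measurable_headCountIndicator u 0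
  have hYN0 : Integrable (fun y => (∑' u, (if (∑ s ∈ Finset.range u, (if (y (s + 1)).2 then (1 : ℕ) else 0)) = 0 then (1 : ℝ) else 0) * f (y u).1) * (∑' u, (if (∑ s ∈ Finset.range u, (if (y (s + 1)).2 then (1 : ℕ) else 0)) = 0 then (1 : ℝ) else 0))) Pν := by
    refine Integrable.mono' ((hY0sq.add hN0sq).div_const 2) (hYm0.mul hNm0).aestronglyMeasurable
      (ae_of_all _ fun y => ?_)
    simp only [Pi.add_apply]
    rw [Real.norm_eq_abs, abs_mul]
    nlinarith [sq_nonneg (|(∑' u, (if (∑ s ∈ Finset.range u, (if (y (s + 1)).2 then (1 : ℕ) else 0)) = 0 then (1 : ℝ) else 0) * f (y u).1)| - |(∑' u, (if (∑ s ∈ Finset.range u, (if (y (s + 1)).2 then (1 : ℕ) else 0)) = 0 then (1 : ℝ) else 0))|), sq_abs (∑' u, (if (∑ s ∈ Finset.range u, (if (y (s + 1)).2 then (1 : ℕ) else 0)) = 0 then (1 : ℝ) else 0) * f (y u).1), sq_abs (∑' u, (if (∑ s ∈ Finset.range u, (if (y (s + 1)).2 then (1 : ℕ) else 0)) = 0 then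 (1 : ℝ) else 0))]
  have hlim : (∫ y, (∑' u, (if (∑ s ∈ Finset.range u, (if (y (s + 1)).2 then (1 : ℕ) else 0)) = 0 then (1 : ℝ) else 0) * f (y u).1) ^ 2 ∂Pν) - 2 * c * (∫ y, (∑' u, (if (∑ s ∈ Finset.range u, (if (y (s + 1)).2 then (1 : ℕ) else 0)) = 0 then (1 : ℝ) else 0) * f (y u).1) * (∑' u, (if (∑ s ∈ Finset.range u, (if (y (s + 1)).2 then (1 : ℕ) else 0)) = 0 then (1 : ℝ) else 0)) ∂Pν)
      + c ^ 2 * (∫ y, (∑' u, (if (∑ s ∈ Finset.range u, (if (y (s + 1)).2 then (1 : ℕ) else 0)) = 0 then (1 : ℝ) else 0)) ^ 2 ∂Pν) = σ2 / ε.toReal := by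
    have hv : ε.toReal * ∫ y, (∑' u, (if (∑ s ∈ Finset.range u, (if (y (s + 1)).2 then (1 : ℕ) else 0)) = 0 then (1 : ℝ) else 0) * (f (y u).1 - ∫ z, f z ∂π)) ^ 2 ∂Pν = σ2 := by
      rw [hPν]
      exact splitChain_fresh_sq_centredTourSum_eq_greenKubo κs (κ := κ) (ν := ν) (hmin := hmin) hπ hε0
        hε hκs hf hC
    -- `∫ Z_0² = ∫ (Y_0 − c N_0)²` (tour `0` ends a.s.) `= ∫Y_0² − 2c∫Y_0N_0 + c²∫N_0²`
    have hae0 := splitChain_ae_tourStart κs (ν.map (fun y : Ω => (y, true))) (κ := κ) (ν := ν)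
      (hmin := hmin) hε0 hε hκs
    rw [← hPν] at hae0
    have hZ : ∀ᵐ y ∂Pν, (∑' u, (if (∑ s ∈ Finset.range u, (if (y (s + 1)).2 then (1 : ℕ) else 0)) = 0 then (1 : ℝ) else 0) * (f (y u).1 - ∫ z, f z ∂π)) ^ 2
        = (∑' u, (if (∑ s ∈ Finset.range u, (if (y (s + 1)).2 then (1 : ℕ) else 0)) = 0 then (1 : ℝ) else 0) * f (y u).1) ^ 2 - 2 * c * ((∑' u, (if (∑ s ∈ Finset.range u, (if (y (s + 1)).2 then (1 : ℕ) else 0)) = 0 then (1 : ℝ) else 0) * f (y u).1) * (∑' u, (if (∑ s ∈ Finset.range u, (if (y (s + 1)).2 then (1 : ℕ) else 0)) = 0 then (1 : ℝ) else 0))) + c ^ 2 * (∑' u, (if (∑ s ∈ Finset.range u, (if (y (s + 1)).2 then (1 : ℕ) else 0)) = 0 then (1 : ℝ) else 0)) ^ 2 := by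
      filter_upwards [hae0] with y hy
      obtain ⟨t, ht, hh⟩ := hy 0
      rw [tourSum_eq_finsetSum (fun p _ => f p.1 - c) y le_rfl ht hh,
        tourSum_eq_finsetSum (fun p _ => f p.1) y le_rfl ht hh, tourLength_eq_finsetSum y le_rfl ht hh]
      have : (∑ u ∈ Finset.range (t + 1), (if (∑ s ∈ Finset.range u, (if (y (s + 1)).2 then (1 : ℕ) else 0)) = 0 then (1 : ℝ) else 0) * (f (y u).1 - c))
          = (∑ u ∈ Finset.range (t + 1), (if (∑ s ∈ Finset.range u, (if (y (s + 1)).2 then (1 : ℕ) else 0)) = 0 then (1 : ℝ) else 0) * f (y u).1)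
            - c * (∑ u ∈ Finset.range (t + 1), (if (∑ s ∈ Finset.range u, (if (y (s + 1)).2 then (1 : ℕ) else 0)) = 0 then (1 : ℝ) else 0)) := by
        rw [Finset.mul_sum, ← Finset.sum_sub_distrib]
        exact Finset.sum_congr rfl fun u _ => by ring
      rw [this]; ring
    have hint : ∫ y, (∑' u, (if (∑ s ∈ Finset.range u, (if (y (s + 1)).2 then (1 : ℕ) else 0)) = 0 then (1 : ℝ) else 0) * (f (y u).1 - ∫ z, f z ∂π)) ^ 2 ∂Pν = (∫ y, (∑' u, (if (∑ s ∈ Finset.range u, (if (y (s + 1)).2 then (1 : ℕ) else 0)) = 0 then (1 : ℝ) else 0) * f (y u).1) ^ 2 ∂Pν)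
        - 2 * c * (∫ y, (∑' u, (if (∑ s ∈ Finset.range u, (if (y (s + 1)).2 then (1 : ℕ) else 0)) = 0 then (1 : ℝ) else 0) * f (y u).1) * (∑' u, (if (∑ s ∈ Finset.range u, (if (y (s + 1)).2 then (1 : ℕ) else 0)) = 0 then (1 : ℝ) else 0)) ∂Pν) + c ^ 2 * (∫ y, (∑' u, (if (∑ s ∈ Finset.range u, (if (y (s + 1)).2 then (1 : ℕ) else 0)) = 0 then (1 : ℝ) else 0)) ^ 2 ∂Pν) := by
      rw [integral_congr_ae hZ]
      have e1 : ∫ y, ((∑' u, (if (∑ s ∈ Finset.range u, (if (y (s + 1)).2 then (1 : ℕ) else 0)) = 0 then (1 : ℝ) else 0) * f (y u).1) ^ 2 - 2 * c * ((∑' u, (if (∑ s ∈ Finset.range u, (if (y (s + 1)).2 then (1 : ℕ) else 0)) = 0 then (1 : ℝ) else 0) * f (y u).1) * (∑' u, (if (∑ s ∈ Finset.range u, (if (y (s + 1)).2 then (1 : ℕ) else 0)) = 0 then (1 : ℝ) else 0)))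
          + c ^ 2 * (∑' u, (if (∑ s ∈ Finset.range u, (if (y (s + 1)).2 then (1 : ℕ) else 0)) = 0 then (1 : ℝ) else 0)) ^ 2) ∂Pν = (∫ y, ((∑' u, (if (∑ s ∈ Finset.range u, (if (y (s + 1)).2 then (1 : ℕ) else 0)) = 0 then (1 : ℝ) else 0) * f (y u).1) ^ 2 - 2 * c * ((∑' u, (if (∑ s ∈ Finset.range u, (if (y (s + 1)).2 then (1 : ℕ) else 0)) = 0 then (1 : ℝ) else 0) * f (y u).1) * (∑' u, (if (∑ s ∈ Finset.range u, (if (y (s + 1)).2 then (1 : ℕ) else 0)) = 0 then (1 : ℝ) else 0)))) ∂Pν)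
            + ∫ y, c ^ 2 * (∑' u, (if (∑ s ∈ Finset.range u, (if (y (s + 1)).2 then (1 : ℕ) else 0)) = 0 then (1 : ℝ) else 0)) ^ 2 ∂Pν :=
        integral_add (hY0sq.sub (hYN0.const_mul _)) (hN0sq.const_mul _)
      have e2 : ∫ y, ((∑' u, (if (∑ s ∈ Finset.range u, (if (y (s + 1)).2 then (1 : ℕ) else 0)) = 0 then (1 : ℝ) else 0) * f (y u).1) ^ 2 - 2 * c * ((∑' u, (if (∑ s ∈ Finset.range u, (if (y (s + 1)).2 then (1 : ℕ) else 0)) = 0 then (1 : ℝ) else 0) * f (y u).1) * (∑' u, (if (∑ s ∈ Finset.range u, (if (y (s + 1)).2 then (1 : ℕ) else 0)) = 0 then (1 : ℝ) else 0)))) ∂Pν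
          = (∫ y, (∑' u, (if (∑ s ∈ Finset.range u, (if (y (s + 1)).2 then (1 : ℕ) else 0)) = 0 then (1 : ℝ) else 0) * f (y u).1) ^ 2 ∂Pν) - ∫ y, 2 * c * ((∑' u, (if (∑ s ∈ Finset.range u, (if (y (s + 1)).2 then (1 : ℕ) else 0)) = 0 then (1 : ℝ) else 0) * f (y u).1) * (∑' u, (if (∑ s ∈ Finset.range u, (if (y (s + 1)).2 then (1 : ℕ) else 0)) = 0 then (1 : ℝ) else 0))) ∂Pν :=
        integral_sub hY0sq (hYN0.const_mul _)
      rw [e1, e2, integral_const_mul, integral_const_mul]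
    rw [eq_div_iff he0.ne', ← hint, mul_comm]
    exact hv
  -- the almost sure limits
  have hprod := splitChain_tourPairProducts_strongLaw κs μs (κ := κ) (ν := ν) (hmin := hmin) hε0 hε hκs
    hf hC
  have hA := regenerative_estimator_strongLaw κs μs (κ := κ) (ν := ν) (hmin := hmin) hπ hε0 hε hκs hf hC
  rw [← hP, ← hPν] at hprod
  rw [← hP] at hA
  filter_upwards [hprod, hA] with x hx hAx
  obtain ⟨h1, h2, h3⟩ := hx
  have halg : ∀ R : ℕ, ((∑ i ∈ Finset.range R, ((∑' u, (if (∑ s ∈ Finset.range u, (if (x (s + 1)).2 then (1 : ℕ) else 0)) = i + 1 then (1 : ℝ) else 0) * f (x u).1) - ((∑ i ∈ Finset.range R, (∑' u, (if (∑ s ∈ Finset.range u, (if (x (s + 1)).2 then (1 : ℕ) else 0)) = i + 1 then (1 : ℝ) else 0) * f (x u).1)) / (∑ i ∈ Finset.range R, (∑' u, (if (∑ s ∈ Finset.range u, (if (x (s + 1)).2 then (1 : ℕ) else 0)) = i + 1 then (1 : ℝ) else 0)))) * (∑' u, (if (∑ s ∈ Finset.range u, (if (x (s + 1)).2 then (1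 : ℕ) else 0)) = i + 1 then (1 : ℝ) else 0))) ^ 2) / R)
      = (∑ i ∈ Finset.range R, (∑' u, (if (∑ s ∈ Finset.range u, (if (x (s + 1)).2 then (1 : ℕ) else 0)) = i + 1 then (1 : ℝ) else 0) * f (x u).1) ^ 2) / R
        - 2 * ((∑ i ∈ Finset.range R, (∑' u, (if (∑ s ∈ Finset.range u, (if (x (s + 1)).2 then (1 : ℕ) else 0)) = i + 1 then (1 : ℝ) else 0) * f (x u).1)) / (∑ i ∈ Finset.range R, (∑' u, (if (∑ s ∈ Finset.range u, (if (x (s + 1)).2 then (1 : ℕ) else 0)) = i + 1 then (1 : ℝ) else 0)))) * ((∑ i ∈ Finset.range R, (∑' u, (if (∑ s ∈ Finset.range u, (if (x (s + 1)).2 then (1 : ℕ) else 0)) = i + 1 then (1 : ℝ) else 0) * f (x u).1) * (∑' u, (if (∑ s ∈ Finset.range u, (if (x (s + 1)).2 then (1 : ℕ) else 0)) = i + 1 then (1 : ℝ) else 0))) / R)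
        + ((∑ i ∈ Finset.range R, (∑' u, (if (∑ s ∈ Finset.range u, (if (x (s + 1)).2 then (1 : ℕ) else 0)) = i + 1 then (1 : ℝ) else 0) * f (x u).1)) / (∑ i ∈ Finset.range R, (∑' u, (if (∑ s ∈ Finset.range u, (if (x (s + 1)).2 then (1 : ℕ) else 0)) = i + 1 then (1 : ℝ) else 0)))) ^ 2 * ((∑ i ∈ Finset.range R, (∑' u, (if (∑ s ∈ Finset.range u, (if (x (s + 1)).2 then (1 : ℕ) else 0)) = i + 1 then (1 : ℝ) else 0)) ^ 2) / R) := by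
    intro R
    have hexp : (∑ i ∈ Finset.range R, ((∑' u, (if (∑ s ∈ Finset.range u, (if (x (s + 1)).2 then (1 : ℕ) else 0)) = i + 1 then (1 : ℝ) else 0) * f (x u).1) - ((∑ i ∈ Finset.range R, (∑' u, (if (∑ s ∈ Finset.range u, (if (x (s + 1)).2 then (1 : ℕ) else 0)) = i + 1 then (1 : ℝ) else 0) * f (x u).1)) / (∑ i ∈ Finset.range R, (∑' u, (if (∑ s ∈ Finset.range u, (if (x (s + 1)).2 then (1 : ℕ) else 0)) = i + 1 then (1 : ℝ) else 0)))) * (∑' u, (if (∑ s ∈ Finset.range u, (if (x (s + 1)).2 then (1 : ℕ) else 0)) = i + 1 then (1 : ℝ) else 0))) ^ 2)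
        = (∑ i ∈ Finset.range R, (∑' u, (if (∑ s ∈ Finset.range u, (if (x (s + 1)).2 then (1 : ℕ) else 0)) = i + 1 then (1 : ℝ) else 0) * f (x u).1) ^ 2)
          - 2 * ((∑ i ∈ Finset.range R, (∑' u, (if (∑ s ∈ Finset.range u, (if (x (s + 1)).2 then (1 : ℕ) else 0)) = i + 1 then (1 : ℝ) else 0) * f (x u).1)) / (∑ i ∈ Finset.range R, (∑' u, (if (∑ s ∈ Finset.range u, (if (x (s + 1)).2 then (1 : ℕ) else 0)) = i + 1 then (1 : ℝ) else 0)))) * (∑ i ∈ Finset.range R, (∑' u, (if (∑ s ∈ Finset.range u, (if (x (s + 1)).2 then (1 : ℕ) else 0)) = i + 1 then (1 : ℝ) else 0) * f (x u).1) * (∑' u, (if (∑ s ∈ Finset.range u, (if (x (s + 1)).2 then (1 : ℕ) else 0)) = i + 1 then (1 : ℝ) else 0)))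
          + ((∑ i ∈ Finset.range R, (∑' u, (if (∑ s ∈ Finset.range u, (if (x (s + 1)).2 then (1 : ℕ) else 0)) = i + 1 then (1 : ℝ) else 0) * f (x u).1)) / (∑ i ∈ Finset.range R, (∑' u, (if (∑ s ∈ Finset.range u, (if (x (s + 1)).2 then (1 : ℕ) else 0)) = i + 1 then (1 : ℝ) else 0)))) ^ 2 * (∑ i ∈ Finset.range R, (∑' u, (if (∑ s ∈ Finset.range u, (if (x (s + 1)).2 then (1 : ℕ) else 0)) = i + 1 then (1 : ℝ) else 0)) ^ 2) := by
      rw [Finset.mul_sum, Finset.mul_sum, ← Finset.sum_sub_distrib, ← Finset.sum_add_distrib]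
      exact Finset.sum_congr rfl fun i _ => by ring
    rw [hexp]
    ring
  have hT := (h1.sub ((hAx.const_mul 2).mul h2)).add ((hAx.pow 2).mul h3)
  rw [hlim] at hT
  refine hT.congr fun R => ?_
  rw [halg R]

/-- **THE GREEN–KUBO VARIANCE FROM ONE RUN, STRONGLY CONSISTENTLY**: almost surely
`σ̂²_R := V̂_R / N̄_R → σ²_f` (`N̄_R = Σ_{i<R} N_{i+1} / R`). -/
theorem regenerative_sigma_strongLaw {π : Measure Ω} [IsProbabilityMeasure π]
    (hπ : Kernel.Invariant κ π) (hε0 : 0 < ε) (hε : ε < 1)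
    (hκs : ∀ p, κs p = (ε • ν).map (fun y : Ω => (y, true))
      + ((1 - ε) • Doeblin.residualKernel κ ν ε hmin p.1).map (fun y : Ω => (y, false)))
    {f : Ω → ℝ} (hf : Measurable f) {C : ℝ} (hC : ∀ x, |f x| ≤ C) :
    ∀ᵐ x ∂(Kernel.trajMeasure (X := fun _ : ℕ => Ω × Bool) μs
        (fun m : ℕ => κs.comap (fun h : (i : ↥(Finset.Iic m)) → Ω × Bool =>
          h ⟨m, Finset.mem_Iic.2 le_rfl⟩) (measurable_pi_apply _))),
      Tendsto (fun R : ℕ => ((∑ i ∈ Finset.range R, ((∑' u, (if (∑ s ∈ Finset.range u, (if (x (s + 1)).2 then (1 : ℕ) else 0)) = i + 1 then (1 : ℝ) else 0) * f (x u).1) - ((∑ i ∈ Finset.range R, (∑' u, (if (∑ s ∈ Finset.range u, (if (x (s + 1)).2 then (1 : ℕ) else 0)) = i + 1 then (1 : ℝ) else 0) * f (x u).1)) / (∑ i ∈ Finset.range R, (∑' u, (if (∑ s ∈ Finset.range u, (if (x (s + 1)).2 then (1 : ℕ) else 0)) = i + 1 then (1 : ℝ) else 0)))) * (∑' u, (if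 (∑ s ∈ Finset.range u, (if (x (s + 1)).2 then (1 : ℕ) else 0)) = i + 1 then (1 : ℝ) else 0))) ^ 2) / R) / ((∑ i ∈ Finset.range R, (∑' u, (if (∑ s ∈ Finset.range u, (if (x (s + 1)).2 then (1 : ℕ) else 0)) = i + 1 then (1 : ℝ) else 0))) / R)) atTop (𝓝 ((∫ y, (f y - ∫ z, f z ∂π) ^ 2 ∂π)
      + 2 * ∑' k, ∫ y, (f y - ∫ z, f z ∂π) * (kop κ)^[k + 1] (fun y => f y - ∫ z, f z ∂π) y ∂π)) := by
  have he0 : 0 < ε.toReal := ENNReal.toReal_pos hε0.ne' (ne_top_of_lt hε)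
  filter_upwards [regenerative_variance_strongLaw κs μs (κ := κ) (ν := ν) (hmin := hmin) hπ hε0 hε hκs
    hf hC, splitChain_tourLength_strongLaw κs μs (κ := κ) (ν := ν) (hmin := hmin) hε0 hε hκs]
    with x hV hN
  have h := hV.div hN (by positivity)
  rw [show ((∫ y, (f y - ∫ z, f z ∂π) ^ 2 ∂π)
      + 2 * ∑' k, ∫ y, (f y - ∫ z, f z ∂π) * (kop κ)^[k + 1] (fun y => f y - ∫ z, f z ∂π) y ∂π) / ε.toReal / (1 / ε.toReal) = ((∫ y, (f y - ∫ z, f z ∂π) ^ 2 ∂π)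
      + 2 * ∑' k, ∫ y, (f y - ∫ z, f z ∂π) * (kop κ)^[k + 1] (fun y => f y - ∫ z, f z ∂π) y ∂π) by field_simp] at h
  exact h

end VarianceSLLN

end Summit.Ventures.LatticeQCDFlow.Scoring
end
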